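import Summits.BirchSwinnertonDyer.BirchSwinnertonDyer.Theorems.EisensteinDepletionAtTwoStarOptBNSFParityGroup
import HarnessLib

/-!
# The twisted parity group of a character discrepancy (cruxes `StarGO2Sigma` 27046 / `StarOptBNSF` 27047): THEOREM A step (1), `J₀(N)` side

Companion of `Theorems/EisensteinDepletionAtTwoStarOptBNSFParityGroup.lean` (p640466).  On line `kummer` (crux
`StarGO2Sigma`, item stmt-BirchSwinnertonDyer-27046, planner p2 GEN 32) the research stub `stub_gammaOneParity` (ii) says
that on `Γ₁(N)` the parity of the depleted Eisenstein period `φ_β(γ)/g'` equals the Kummer parity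
`[q·{∞, γ∞}_f ∈ ℤλ + 2Λ]` of the cusp symbol; on paper this is THEOREM B (the DISCREPANCY of the two parities is the
monodromy character `χ_R` of a rational `2`-torsion point `R` of `J₀(N)` FORMAL at `2`) + THEOREM A (`χ_R` vanishes on
`Γ₁(N)`: unbounded denominators + Wohlfahrt).  THEOREM A's steps (4)–(5) are the tree's congruence core
(`…DepletionAtTwo.CongruenceCore.false_of_antiinvariant_integral_cuspForm`, p639511), which needs the KERNEL of the
discrepancy as a finite-index subgroup `Γ″ ≤ SL(2, ℤ)` containing every unipotent of `Γ₁(N)`.  This file supplies that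
subgroup, definition-free, for an ABSTRACT additive period functional `φ : Γ₀(N) → ℚ` with cyclic value group `ℤ·g'`,
`g' ≠ 0` (for `φ = φ_β` these are the tree's `stabEisensteinPeriod_mul` and eng-2's `stub_eisImageCyclic`):

  `γ ∈ Γ″ ↔ ∃ (hγ : γ ∈ Γ₀(N)), γ ∈ Γ₁(N) ∧ ((∃ n : ℤ, φ γ = n·g' ∧ Even n) ↔ q·{∞, γ∞}_f ∈ ℤλ + 2Λ)`      (★★)

* `exists_twistedParityGroup` — such a `Γ″` exists (both parities are characters: `φ` additive with values in `ℤg'`;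
  Manin additivity + eng-2's index-`2` count for the symbol side);
* `finiteIndex_of_twistedParity` — `Γ″` has finite index (kernel of the discrepancy character `Γ₁(N) → ℤ/2`);
* `mem_of_trace_eq_two_of_cuspEven` — every trace-`2` element of `Γ₁(N)` lies in `Γ″` PROVIDED `φ(P)/g'` is even for
  every such `P` («`h_β` is cuspidal mod `2g'` at every cusp of `Γ₁(N)`», the Eisenstein-side cusp condition of THEOREM B;
  the symbol side is the tree's `cuspSymbol_eq_zero_of_discr_eq_zero`).

So, for any future cut of `stub_gammaOneParity`: (ii) at `γ₀ ∈ Γ₁(N)` FAILS ⇒ `γ₀ ∉ Γ″` ⇒ (with an anti-invariant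
integral weight-`2` cusp form on `Γ″` — THEOREM B + THEOREM A steps (2)–(3), the research content) the core gives `False`.
Nothing here reads `r_an`; StarGO2Sigma / StarOptBNSF / E1M_NSF / BSD are NOT proved by this file.
-/

set_option linter.dupNamespace false
set_option autoImplicit false

noncomputable section

open scoped MatrixGroups
open CongruenceSubgroup
open Literature.NumberTheory.EllipticCurves
open Literature.NumberTheory.EllipticCurves.ModularForms

namespace Summit.BirchSwinnertonDyer.BirchSwinnertonDyer.Theorems.DepletionAtTwo.TwistedParityGroup

variable {N : ℕ}

/-! ### The Eisenstein-side parity of an additive functional with cyclic value group -/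

/-- For an additive `φ : Γ₀(N) → ℚ` with values in `ℤ·g'`, `g' ≠ 0`, the predicate «`φ γ ∈ 2ℤ·g'`» is a character:
`E(γδ) ↔ (E γ ↔ E δ)`. [folklore] -/
theorem eisParity_mul_iff (φ : Gamma0 N → ℚ) (hφ : ∀ γ δ : Gamma0 N, φ (γ * δ) = φ γ + φ δ) {g' : ℚ}
    (hg : g' ≠ 0) (hval : ∀ γ : Gamma0 N, ∃ n : ℤ, φ γ = n * g') (γ δ : Gamma0 N) :
    (∃ n : ℤ, φ (γ * δ) = n * g' ∧ Even n) ↔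
      ((∃ n : ℤ, φ γ = n * g' ∧ Even n) ↔ (∃ n : ℤ, φ δ = n * g' ∧ Even n)) := by
  obtain ⟨a, ha⟩ := hval γ
  obtain ⟨b, hb⟩ := hval δ
  have hab : φ (γ * δ) = ((a + b : ℤ) : ℚ) * g' := by rw [hφ, ha, hb]; push_cast; ring
  -- uniqueness of the integer coordinate
  have huniq : ∀ {x : ℚ} {m n : ℤ}, x = m * g' → x = n * g' → m = n := by
    intro x m n hm hn
    have : (m : ℚ) = n := mul_right_cancel₀ hg (hm.symm.trans hn)
    exact_mod_cast this
  have eγ : (∃ n : ℤ, φ γ = n * g' ∧ Even n) ↔ Even a :=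
    ⟨fun ⟨n, hn, he⟩ ↦ huniq hn ha ▸ he, fun he ↦ ⟨a, ha, he⟩⟩
  have eδ : (∃ n : ℤ, φ δ = n * g' ∧ Even n) ↔ Even b :=
    ⟨fun ⟨n, hn, he⟩ ↦ huniq hn hb ▸ he, fun he ↦ ⟨b, hb, he⟩⟩
  have eγδ : (∃ n : ℤ, φ (γ * δ) = n * g' ∧ Even n) ↔ Even (a + b) :=
    ⟨fun ⟨n, hn, he⟩ ↦ huniq hn hab ▸ he, fun he ↦ ⟨a + b, hab, he⟩⟩
  rw [eγ, eδ, eγδ, Int.even_add]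

/-- `φ 1 ∈ 2ℤ·g'` (indeed `φ 1 = 0`). [folklore] -/
theorem eisParity_one (φ : Gamma0 N → ℚ) (hφ : ∀ γ δ : Gamma0 N, φ (γ * δ) = φ γ + φ δ) (g' : ℚ) :
    ∃ n : ℤ, φ 1 = n * g' ∧ Even n := by
  have h1 : φ 1 = 0 := by
    have := hφ 1 1
    rw [one_mul] at this
    linarith
  exact ⟨0, by rw [h1]; simp, ⟨0, rfl⟩⟩

/-! ### The twisted parity group -/

/-- Propositional bookkeeping: the «agreement» of two characters is a character. [folklore] -/
theorem iff_character_aux {A B C A' B' C' : Prop} (h₁ : A ↔ (B ↔ C)) (h₂ : A' ↔ (B' ↔ C')) :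
    (A ↔ A') ↔ ((B ↔ B') ↔ (C ↔ C')) := by
  tauto

section Hypotheses

variable [NeZero N] (f : CuspForm (Gamma0 N) 2) (L : PeriodPair) (q : ℚ) {lam : ℂ}
  (hin : ∀ z ∈ periodLatticeGamma1 f, (q : ℂ) * z ∈ L.lattice)
  (hlam : lam ∈ L.lattice) (hlam2 : lam / 2 ∉ L.lattice)
  (φ : Gamma0 N → ℚ) (hφ : ∀ γ δ : Gamma0 N, φ (γ * δ) = φ γ + φ δ) {g' : ℚ}
  (hg : g' ≠ 0) (hval : ∀ γ : Gamma0 N, ∃ n : ℤ, φ γ = n * g')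

include hin hlam hlam2 hφ hg hval in
/-- **Multiplicativity of the discrepancy**: for `γ, δ ∈ Γ₁(N)` the predicate
`M(γ) := (φ γ ∈ 2ℤg' ↔ q·{∞,γ∞}_f ∈ ℤλ + 2Λ)` satisfies `M(γδ) ↔ (M γ ↔ M δ)` (both sides are characters:
`eisParity_mul_iff` and `ParityGroup.parity_mul_iff`). [folklore] -/
theorem discrepancy_mul_iff {γ δ : SL(2, ℤ)} (hγ0 : γ ∈ Gamma0 N) (hγ1 : γ ∈ Gamma1 N)
    (hδ0 : δ ∈ Gamma0 N) (hδ1 : δ ∈ Gamma1 N) :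
    ((∃ n : ℤ, φ ⟨γ * δ, mul_mem hγ0 hδ0⟩ = n * g' ∧ Even n) ↔
        ∃ k : ℤ, ∃ w ∈ L.lattice,
          (q : ℂ) * cuspSymbol f ⟨γ * δ, mul_mem hγ0 hδ0⟩ = (k : ℂ) * lam + 2 * w) ↔
      (((∃ n : ℤ, φ ⟨γ, hγ0⟩ = n * g' ∧ Even n) ↔
          ∃ k : ℤ, ∃ w ∈ L.lattice, (q : ℂ) * cuspSymbol f ⟨γ, hγ0⟩ = (k : ℂ) * lam + 2 * w) ↔
        ((∃ n : ℤ, φ ⟨δ, hδ0⟩ = n * g' ∧ Even n) ↔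
          ∃ k : ℤ, ∃ w ∈ L.lattice, (q : ℂ) * cuspSymbol f ⟨δ, hδ0⟩ = (k : ℂ) * lam + 2 * w)) := by
  have hE : (∃ n : ℤ, φ ⟨γ * δ, mul_mem hγ0 hδ0⟩ = n * g' ∧ Even n) ↔
      ((∃ n : ℤ, φ ⟨γ, hγ0⟩ = n * g' ∧ Even n) ↔ (∃ n : ℤ, φ ⟨δ, hδ0⟩ = n * g' ∧ Even n)) :=
    eisParity_mul_iff φ hφ hg hval ⟨γ, hγ0⟩ ⟨δ, hδ0⟩
  have hS := ParityGroup.parity_mul_iff f L q hin hlam hlam2 hγ0 hγ1 hδ0 hδ1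
  exact iff_character_aux hE hS

include hin hlam hlam2 hφ hg hval in
/-- **The twisted parity group exists**: under the standing hypotheses the set (★★) is a subgroup of `SL(2, ℤ)`.
[folklore] -/
theorem exists_twistedParityGroup :
    ∃ Γ'' : Subgroup SL(2, ℤ), ∀ γ : SL(2, ℤ), γ ∈ Γ'' ↔ ∃ hγ : γ ∈ Gamma0 N, γ ∈ Gamma1 N ∧
      ((∃ n : ℤ, φ ⟨γ, hγ⟩ = n * g' ∧ Even n) ↔
        ∃ k : ℤ, ∃ w ∈ L.lattice, (q : ℂ) * cuspSymbol f ⟨γ, hγ⟩ = (k : ℂ) * lam + 2 * w) := by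
  refine ⟨{ carrier := {γ | ∃ hγ : γ ∈ Gamma0 N, γ ∈ Gamma1 N ∧
              ((∃ n : ℤ, φ ⟨γ, hγ⟩ = n * g' ∧ Even n) ↔
                ∃ k : ℤ, ∃ w ∈ L.lattice, (q : ℂ) * cuspSymbol f ⟨γ, hγ⟩ = (k : ℂ) * lam + 2 * w)}
            mul_mem' := fun {γ δ} hγ' hδ' ↦ ?_
            one_mem' := ?_
            inv_mem' := fun {γ} hγ' ↦ ?_ }, fun γ ↦ Iff.rfl⟩
  · obtain ⟨hγ0, hγ1, hγ⟩ := hγ'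
    obtain ⟨hδ0, hδ1, hδ⟩ := hδ'
    exact ⟨mul_mem hγ0 hδ0, mul_mem hγ1 hδ1,
      (discrepancy_mul_iff f L q hin hlam hlam2 φ hφ hg hval hγ0 hγ1 hδ0 hδ1).mpr (iff_of_true hγ hδ)⟩
  · refine ⟨one_mem _, one_mem _, iff_of_true ?_ ?_⟩
    · exact eisParity_one φ hφ g'
    · have e : (⟨1, one_mem _⟩ : Gamma0 N) = 1 := rfl
      rw [e, cuspSymbol_one, mul_zero]
      exact ParityGroup.zero_mem_half L lam
  · obtain ⟨hγ0, hγ1, hγ⟩ := hγ'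
    refine ⟨inv_mem hγ0, inv_mem hγ1, ?_⟩
    -- `M(γ⁻¹) ↔ M(γ)`: from `M(γ⁻¹ γ) = M(1)` true and multiplicativity
    have hm := discrepancy_mul_iff f L q hin hlam hlam2 φ hφ hg hval (inv_mem hγ0) (inv_mem hγ1) hγ0 hγ1
    have h1 : (∃ n : ℤ, φ ⟨γ⁻¹ * γ, mul_mem (inv_mem hγ0) hγ0⟩ = n * g' ∧ Even n) ↔
        ∃ k : ℤ, ∃ w ∈ L.lattice,
          (q : ℂ) * cuspSymbol f ⟨γ⁻¹ * γ, mul_mem (inv_mem hγ0) hγ0⟩ = (k : ℂ) * lam + 2 * w := by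
      have e : (⟨γ⁻¹ * γ, mul_mem (inv_mem hγ0) hγ0⟩ : Gamma0 N) = 1 := by
        apply Subtype.ext; simp
      rw [e, cuspSymbol_one, mul_zero]
      exact iff_of_true (eisParity_one φ hφ g') (ParityGroup.zero_mem_half L lam)
    exact (hm.mp h1).mpr hγ

omit [NeZero N] in
/-- A subgroup with membership (★★) lies in `Γ₁(N)`. [folklore] -/
theorem le_gamma1_of_twistedParity {Γ'' : Subgroup SL(2, ℤ)}
    (hΓ : ∀ γ : SL(2, ℤ), γ ∈ Γ'' ↔ ∃ hγ : γ ∈ Gamma0 N, γ ∈ Gamma1 N ∧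
      ((∃ n : ℤ, φ ⟨γ, hγ⟩ = n * g' ∧ Even n) ↔
        ∃ k : ℤ, ∃ w ∈ L.lattice, (q : ℂ) * cuspSymbol f ⟨γ, hγ⟩ = (k : ℂ) * lam + 2 * w)) :
    Γ'' ≤ Gamma1 N := by
  intro γ hγ
  obtain ⟨-, hγ1, -⟩ := (hΓ γ).mp hγ
  exact hγ1

/-- **Étale at the cusps, given the Eisenstein-side cusp condition**: if `φ(P) ∈ 2ℤ·g'` for every trace-`2` element
`P ∈ Γ₁(N)` («the depleted Eisenstein series is cuspidal mod `2g'` at every cusp of `Γ₁(N)`»), then every such `P` lies in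
a subgroup with membership (★★) (the symbol side vanishes: tree `cuspSymbol_eq_zero_of_discr_eq_zero`).
[cite: Knapp1993, Prop. 11.1] -/
theorem mem_of_trace_eq_two_of_cuspEven {Γ'' : Subgroup SL(2, ℤ)}
    (hΓ : ∀ γ : SL(2, ℤ), γ ∈ Γ'' ↔ ∃ hγ : γ ∈ Gamma0 N, γ ∈ Gamma1 N ∧
      ((∃ n : ℤ, φ ⟨γ, hγ⟩ = n * g' ∧ Even n) ↔
        ∃ k : ℤ, ∃ w ∈ L.lattice, (q : ℂ) * cuspSymbol f ⟨γ, hγ⟩ = (k : ℂ) * lam + 2 * w))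
    (hcusp : ∀ (γ : SL(2, ℤ)) (hγ : γ ∈ Gamma0 N), γ ∈ Gamma1 N →
      (γ : Matrix (Fin 2) (Fin 2) ℤ).trace = 2 → ∃ n : ℤ, φ ⟨γ, hγ⟩ = n * g' ∧ Even n)
    {γ : SL(2, ℤ)} (hγ1 : γ ∈ Gamma1 N) (htr : (γ : Matrix (Fin 2) (Fin 2) ℤ).trace = 2) :
    γ ∈ Γ'' := by
  have hγ0 : γ ∈ Gamma0 N := Gamma1_in_Gamma0 N hγ1
  refine (hΓ γ).mpr ⟨hγ0, hγ1, iff_of_true (hcusp γ hγ0 hγ1 htr) ?_⟩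
  have hdiscr : ((⟨γ, hγ0⟩ : Gamma0 N) : SL(2, ℤ)).val.discr = 0 := by
    change (γ : Matrix (Fin 2) (Fin 2) ℤ).discr = 0
    rw [Matrix.discr_fin_two, htr, Matrix.SpecialLinearGroup.det_coe]
    norm_num
  rw [cuspSymbol_eq_zero_of_discr_eq_zero f hdiscr, mul_zero]
  exact ParityGroup.zero_mem_half L lam

include hin hlam hlam2 hφ hg hval in
/-- **Finite index**: a subgroup with membership (★★) is, inside `Γ₁(N)`, the kernel of the discrepancy character
`Γ₁(N) → ℤ/2`, so it has index `≤ 2` in `Γ₁(N)` and finite index in `SL(2, ℤ)`. [folklore] -/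
theorem finiteIndex_of_twistedParity {Γ'' : Subgroup SL(2, ℤ)}
    (hΓ : ∀ γ : SL(2, ℤ), γ ∈ Γ'' ↔ ∃ hγ : γ ∈ Gamma0 N, γ ∈ Gamma1 N ∧
      ((∃ n : ℤ, φ ⟨γ, hγ⟩ = n * g' ∧ Even n) ↔
        ∃ k : ℤ, ∃ w ∈ L.lattice, (q : ℂ) * cuspSymbol f ⟨γ, hγ⟩ = (k : ℂ) * lam + 2 * w)) :
    Γ''.FiniteIndex := by
  classical
  let P : Gamma1 N → Prop := fun γ ↦
    (∃ n : ℤ, φ ⟨(γ : SL(2, ℤ)), Gamma1_in_Gamma0 N γ.2⟩ = n * g' ∧ Even n) ↔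
      ∃ k : ℤ, ∃ w ∈ L.lattice,
        (q : ℂ) * cuspSymbol f ⟨(γ : SL(2, ℤ)), Gamma1_in_Gamma0 N γ.2⟩ = (k : ℂ) * lam + 2 * w
  have hPmul : ∀ γ δ : Gamma1 N, P (γ * δ) ↔ (P γ ↔ P δ) := fun γ δ ↦
    discrepancy_mul_iff f L q hin hlam hlam2 φ hφ hg hval (Gamma1_in_Gamma0 N γ.2) γ.2
      (Gamma1_in_Gamma0 N δ.2) δ.2
  have hP1 : P 1 := by
    change (∃ n : ℤ, φ ⟨1, _⟩ = n * g' ∧ Even n) ↔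
      ∃ k : ℤ, ∃ w ∈ L.lattice, (q : ℂ) * cuspSymbol f ⟨1, _⟩ = (k : ℂ) * lam + 2 * w
    rw [show (⟨(1 : SL(2, ℤ)), Gamma1_in_Gamma0 N (1 : Gamma1 N).2⟩ : Gamma0 N) = 1 from rfl,
      cuspSymbol_one, mul_zero]
    exact iff_of_true (eisParity_one φ hφ g') (ParityGroup.zero_mem_half L lam)
  let ψ : Gamma1 N →* Multiplicative (ZMod 2) :=
    { toFun := fun γ ↦ if P γ then 1 else Multiplicative.ofAdd 1
      map_one' := by simp [hP1]
      map_mul' := by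
        intro γ δ
        have h := hPmul γ δ
        by_cases hγ : P γ <;> by_cases hδ : P δ
        · simp [hγ, hδ, h.mpr (iff_of_true hγ hδ)]
        · have : ¬ P (γ * δ) := fun hm ↦ hδ ((h.mp hm).mp hγ)
          simp [hγ, hδ, this]
        · have : ¬ P (γ * δ) := fun hm ↦ hγ ((h.mp hm).mpr hδ)
          simp [hγ, hδ, this]
        · have : P (γ * δ) := h.mpr (iff_of_false hγ hδ)
          simp only [hγ, hδ, this, if_true, if_false, ← ofAdd_add]
          rfl }
  have hker : Γ''.subgroupOf (Gamma1 N) = ψ.ker := by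
    ext γ
    rw [Subgroup.mem_subgroupOf, MonoidHom.mem_ker, hΓ]
    constructor
    · rintro ⟨hγ0, -, hP⟩
      have : P γ := hP
      simp [ψ, this]
    · intro h
      have hP : P γ := by
        by_contra hP
        have h1 : ψ γ = Multiplicative.ofAdd 1 := by simp [ψ, hP]
        rw [h] at h1
        exact absurd (Multiplicative.ofAdd.injective
          (show Multiplicative.ofAdd (0 : ZMod 2) = Multiplicative.ofAdd 1 from h1)) (by decide)
      exact ⟨Gamma1_in_Gamma0 N γ.2, γ.2, hP⟩
  have hrel : Γ''.relIndex (Gamma1 N) ≠ 0 := by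
    change (Γ''.subgroupOf (Gamma1 N)).index ≠ 0
    rw [hker, Subgroup.index_ker]
    exact Nat.card_pos.ne'
  refine ⟨fun h0 ↦ ?_⟩
  have hmul := Subgroup.relIndex_mul_index (le_gamma1_of_twistedParity f L q φ hΓ)
  rw [h0, mul_eq_zero] at hmul
  rcases hmul with h | h
  · exact hrel h
  · exact (instFiniteIndexGamma1 N).index_ne_zero h

end Hypotheses

end Summit.BirchSwinnertonDyer.BirchSwinnertonDyer.Theorems.DepletionAtTwo.TwistedParityGroup

end
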